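import Summits.QuantumFields.YangMills.Theorems.BalabanLadderIRPinnedExit96
import Summits.QuantumFields.YangMills.Theorems.BalabanLadderIRColdPressurePincer
import Summits.QuantumFields.YangMills.Theorems.BalabanLadderIRColdPurityDobrushinCorner
import Summits.QuantumFields.YangMills.Theses.BalabanLadder
import HarnessLib

/-!
# LINE «overlap-ruler» ported to the SUPPLIER crux `IR` — the Fredenhagen–Marcu GLUON-SCREENING (vacuum-overlap) ruler

Unit `ym-ir-idea-21` (IDEATOR lens «barrier»), generation g3, seat `planner-ym-ir-idea-21-g3-0`; rev 1 (§5b only: first lemma F1 → F1′,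
see there) by g5, seat `planner-ym-ir-idea-21-g5-0`, 2026-08-28 — the lens is LAPSED (director №39 ∕ R470-ym), this revision is the owed typing
repair of record, not a new line.  This is the PORT of the IRcof line
`Cruxes/IRcof/Lines/overlap_ruler.lean` (rev 1 cdfaa4f2b811 → rev 2 with the same §5b repair; card `Cruxes/IRcof/Lines/overlap-ruler.md`, idea `Cruxes/IRcof/Ideas/overlap-ruler.md`)
to the supplier crux `Summit.QuantumFields.YangMills.Theses.BalabanLadder.IR` (stmt-QuantumFields-19354), in the manner of LINE 2's port
`Cruxes/IR/Lines/uv_pin.lean`.  Tokens of the supplier slot: PX(1∕24) = the TREE decl `PinnedExit96.PinnedExitAt (1/24)` (imported, not re-typed)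
and N = `ColdPressurePincer.IRnsc`; kernels `PinnedExit96.irsc_of_pinnedExit_le` + `ColdPressurePincer.IR_of_cases` (§6).

HONEST LABEL.  The Clay Yang–Mills mass-gap problem is NOT proved.  `IR` / `IRcof` stand 0∕1.  Nothing here is continuum ∕ OS ∕ Clay content;
R2c stays IDEA-BOUND; every physical number below is GUIDANCE; no MC number is used (E2-Q3 has NO TABLE at filing and nothing depends on it).
BOTH registered stubs S1ev ∕ S2 are WALLS with no located engine beyond strong coupling (PRICE declared).

## What differs from the IRcof line (everything else — ruler, S2, rung, first lemma — is identical text in this namespace)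

PX is an EVENTUALLY-ALL-`β` token (`∃ T β₁, ∀ β ≥ β₁, ∃ L ≥ 8, a(β)·L ≤ T ∧ coldDefect ≤ θ`), so S1 is strengthened from «cofinally in `β`» to
«eventually in `β`»: S1ev `PinnedScreenedEventually` := under `LowerBounds`, `∀ q < 1 ∃ T ∀ L₁ ∃ β₁ ∀ β ≥ β₁ ∃ L ≥ max 16 L₁`, `a(β)·L ≤ T ∧ Q_L ≥ q`
— the genuine Fredenhagen–Marcu statement «FM scale-freeness is reached inside the floor window at EVERY large coupling» (S1ev ⇒ the IRcof line's
S1 trivially).  Composition `px_of_overlap : S1ev → S2(θ) → PinnedExitAt θ` (PROVED, §4) and `IR_of_stubs : Theses.BalabanLadder.IR` (§6) from the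
three stubs S1ev ∕ S2(1∕24) ∕ N.  The ruler (§1): `N_L(R,T)` = Wilson mean of the CHARGED trace of the eared staple (plaquette ears in plane `(2,3)`,
staple `R × T` in plane `(0,1)` there and back, exact Haar-twirl singlet removal), `D_L(R,S)` = Wilson mean of `|tr r(U_∂(R×S))|² − m_r`,
`FM(R,T) = N_L(R,T)∕√D_L(R,2T)`, `u = ⌊L∕16⌋`, `Q_L = FM(4u,2u)∕FM(2u,u)`, `ScreenedAt r β L q : Q_L ≥ q` (division-free with positivity guards);
heuristic values `Q_L → 1` gluon-screened (FM scale-free), `Q_L → q_fem(G) < 1` femto (Gaussian part `2⁻⁴`); CENTRE-BLIND, twist-free, no (CF),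
no case split, NO CONSTANT TYPED (4c(iv)).  Barrier inverted: `Literature.Barriers.QuantumFields.ElitzurTheorem` (its `evasions_known` names the
Fredenhagen–Marcu vacuum-overlap parameter).  Disproof ∕ negatives honoured: S1ev carries `LowerBounds` (p630186 `IR_false_without_LowerBounds`: the
line uses H = the floor at the pin, in S1ev); S1ev is `∃ T … ∀ β ≥ β₁ ∃ L` with `L` depending on `β` — not an instance of `not_uniformExit24`
(`∃ L ∀ β`); no refuted statement of `ledger negatives --problem QuantumFields` is re-asked; neither stub is Iff to E ∕ PX (costume check №13).

References: K. Fredenhagen, M. Marcu, Commun. Math. Phys. 92 (1983) 81 [FredenhagenMarcu1983]; W. Bietenholz, U.-J. Wiese (CUP 2025) §14.11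
[corpus:bietenholz2025 pp. 382–383]; J. Greensite (2011) §3.3, §9.3 [corpus:greensite2011 pp. 29, 114–115]; tree
`Literature.Barriers.QuantumFields.ElitzurTheorem`, `…AbelianDeconfinementD4`, `…NonabelianCoulombPhaseD5`; census REDUCTION-CENSUS v6.7x §C row C4,
§L rows 42 ∕ 44, lit-4 N3.
-/

noncomputable section

open Filter Topology MeasureTheory
open Literature.MathematicalPhysics.QuantumFieldTheory Literature.MathematicalPhysics.QuantumLattice
open Summit.QuantumFields.YangMills.Cruxes.OSLegsFromFemtoAndGap.DlrCollarTransfer (LowerBounds)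
open Summit.QuantumFields.YangMills.Cruxes.IR.ColdPurityBridge (coldDefect)
open Summit.QuantumFields.YangMills.Cruxes.IR.ColdPressurePincer (IRnsc IR_of_cases)
open Summit.QuantumFields.YangMills.Cruxes.IR.PinnedExit96 (PinnedExitAt irsc_of_pinnedExit_le)
open Summit.QuantumFields.YangMills.Cruxes.IR.ColdPurityDobrushin (coldExitAt_corner_of_dobrushinTV)

namespace Summit.QuantumFields.YangMills.Cruxes.IR.OverlapRuler

/-! ## §0 The slot token is the TREE decl `PinnedExit96.PinnedExitAt` (imported by name; nothing re-typed) -/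

/-! ## §1 The gluon-screening (vacuum-overlap) ruler on the slot's boxes `L × L × L × ⌊L∕4⌋` -/

section Ruler

variable {G : Type} [Group G]

/-- `k`-fold shift `x + k e_μ` on the `Fin`-indexed torus (periodic). [folklore] -/
def shiftIter {n₀ n₁ n₂ n₃ : ℕ} (x : FinTorusSite n₀ n₁ n₂ n₃) (μ : Fin 4) : ℕ → FinTorusSite n₀ n₁ n₂ n₃
  | 0 => x
  | k + 1 => (shiftIter x μ k).shift μ

/-- Straight Wilson line of `k` links from `x` in direction `μ`: `U(x,μ) U(x+e_μ,μ) ⋯ U(x+(k−1)e_μ,μ)`. [folklore] -/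
def lineHol {n₀ n₁ n₂ n₃ : ℕ} (U : FinTorusSite n₀ n₁ n₂ n₃ × Fin 4 → G) (x : FinTorusSite n₀ n₁ n₂ n₃) (μ : Fin 4) : ℕ → G
  | 0 => 1
  | k + 1 => lineHol U x μ k * U (shiftIter x μ k, μ)

/-- The STAPLE `x → x + T e₁ → x + T e₁ + R e₀ → x + R e₀` in the plane `(0,1)` (parallel transporter from `x` to `y = x + R e₀`).
[cite: FredenhagenMarcu1983] -/
def stapleHol {n₀ n₁ n₂ n₃ : ℕ} (U : FinTorusSite n₀ n₁ n₂ n₃ × Fin 4 → G) (x : FinTorusSite n₀ n₁ n₂ n₃) (R T : ℕ) : G :=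
  lineHol U x 1 T * lineHol U (shiftIter x 1 T) 0 R * (lineHol U (shiftIter x 0 R) 1 T)⁻¹

/-- The boundary of the rectangle `R × S` in the plane `(0,1)` based at `x` (a Wegner–Wilson loop holonomy). [cite: Wilson1974] -/
def rectHol {n₀ n₁ n₂ n₃ : ℕ} (U : FinTorusSite n₀ n₁ n₂ n₃ × Fin 4 → G) (x : FinTorusSite n₀ n₁ n₂ n₃) (R S : ℕ) : G :=
  lineHol U x 0 R * lineHol U (shiftIter x 0 R) 1 S * (lineHol U (shiftIter x 1 S) 0 R)⁻¹ * (lineHol U x 1 S)⁻¹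

variable {N : ℕ} (ρ : G →* Matrix (Fin N) (Fin N) ℂ)

/-- **The eared-staple trace** `Re tr ρ(P_y⁻¹ · C⁻¹ · P_x · C)`: ears `P_x = U_{x,23}` and the MIRROR ear `P_y⁻¹`, `y = x + R e₀`, joined by
the staple `C` of extent `R × T` in the plane `(0,1)` traversed there AND back — one gauge-invariant closed curve in the representation `ρ`
(the gluon Fredenhagen–Marcu numerator before removing the colour-singlet flux; the mirror orientation of the second ear is the
reflection-positive arrangement for the site reflection in direction `0` through the midpoint of the `R`-leg). [cite: FredenhagenMarcu1983] -/
def earedStapleTr {n₀ n₁ n₂ n₃ : ℕ} (R T : ℕ) (U : FinTorusSite n₀ n₁ n₂ n₃ × Fin 4 → G) (x : FinTorusSite n₀ n₁ n₂ n₃) : ℝ :=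
  (ρ ((finTorusPlaquette U (shiftIter x 0 R) 2 3)⁻¹ * (stapleHol U x R T)⁻¹ * finTorusPlaquette U x 2 3 * stapleHol U x R T)).trace.re

variable [TopologicalSpace G] [IsTopologicalGroup G] [CompactSpace G] [MeasurableSpace G] [BorelSpace G]

/-- **The colour-singlet part of the eared-staple trace, by Haar twirl:** `∫_G Re tr ρ(P_y⁻¹ · C⁻¹ · g⁻¹ · P_x · g · C) dg` — inserting an
independent Haar rotation in the middle of the doubled staple projects `ρ ⊗ ρ̄` onto ALL its singlet channels (`∫ ρ(g)⁻¹ X ρ(g) dg` is the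
conditional expectation onto the commutant `ρ(G)'`, of dimension `m_ρ`); exact for every faithful `ρ`, reducible or not (a `1∕N`-Fierz
subtraction would leave disconnected singlet pieces of size `O(g⁴)` for reducible `ρ` and spoil the femto reading). [folklore] -/
def earedStapleSinglet {n₀ n₁ n₂ n₃ : ℕ} (R T : ℕ) (U : FinTorusSite n₀ n₁ n₂ n₃ × Fin 4 → G) (x : FinTorusSite n₀ n₁ n₂ n₃) : ℝ :=
  ∫ g, (ρ ((finTorusPlaquette U (shiftIter x 0 R) 2 3)⁻¹ * (stapleHol U x R T)⁻¹ * g⁻¹ * finTorusPlaquette U x 2 3 * g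
      * stapleHol U x R T)).trace.re ∂(haarProbability G)

/-- **The CHARGED eared-staple observable** (gluon Fredenhagen–Marcu numerator): trace minus its Haar-twirled singlet part — only colour flux
genuinely transported along the staple survives; vanishes identically for abelian `G`. [cite: FredenhagenMarcu1983] -/
def earedStapleObs {n₀ n₁ n₂ n₃ : ℕ} (R T : ℕ) (U : FinTorusSite n₀ n₁ n₂ n₃ × Fin 4 → G) (x : FinTorusSite n₀ n₁ n₂ n₃) : ℝ :=
  earedStapleTr ρ R T U x - earedStapleSinglet ρ R T U x

/-- **Calibration: the charged eared-staple observable VANISHES ON FLAT CONFIGURATIONS** (`U ≡ 1`): the Haar twirl removes exactly the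
flux-free part (PROVED; the ruler reads transported colour flux only). -/
theorem earedStapleObs_flat {n₀ n₁ n₂ n₃ : ℕ} (R T : ℕ) (x : FinTorusSite n₀ n₁ n₂ n₃) :
    earedStapleObs ρ R T (fun _ => (1 : G)) x = 0 := by
  have hP : ∀ (y : FinTorusSite n₀ n₁ n₂ n₃) (μ ν : Fin 4), finTorusPlaquette (fun _ => (1 : G)) y μ ν = 1 := by
    intro y μ ν; simp [finTorusPlaquette]
  have hL : ∀ (y : FinTorusSite n₀ n₁ n₂ n₃) (μ : Fin 4) (k : ℕ), lineHol (fun _ => (1 : G)) y μ k = 1 := by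
    intro y μ k; induction k <;> simp [lineHol, *]
  have hC : ∀ (y : FinTorusSite n₀ n₁ n₂ n₃) (R T : ℕ), stapleHol (fun _ => (1 : G)) y R T = 1 := by
    intro y R T; simp [stapleHol, hL]
  haveI : IsProbabilityMeasure (haarProbability G) := inferInstance
  simp [earedStapleObs, earedStapleTr, earedStapleSinglet, hP, hC, Matrix.trace_one]

/-- The singlet content `m_ρ = ∫ |tr ρ(g)|² dHaar(g)` of `ρ ⊗ ρ̄` (Schur orthogonality: `dim ρ(G)'`; `1` for irreducible `ρ`). [folklore] -/
def haarTraceSq : ℝ := ∫ g, ‖(ρ g).trace‖ ^ 2 ∂(haarProbability G)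

/-- **The charged rectangle observable** `|tr ρ(U_∂(R × S))|² − m_ρ` (the `ρ ⊗ ρ̄` Wegner–Wilson loop with its singlet part removed —
the «adjoint loop» of Bietenholz–Wiese (14.65) for a general faithful `ρ`). [cite: FredenhagenMarcu1983] -/
def chargedRectObs {n₀ n₁ n₂ n₃ : ℕ} (R S : ℕ) (U : FinTorusSite n₀ n₁ n₂ n₃ × Fin 4 → G) (x : FinTorusSite n₀ n₁ n₂ n₃) : ℝ :=
  ‖(ρ (rectHol U x R S)).trace‖ ^ 2 - haarTraceSq ρ

/-- Wilson's Boltzmann weight on the `Fin`-indexed torus (VERBATIM the integrand of `wilsonFinTorusPartition`). [cite: Wilson1974] -/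
def finTorusWilsonWeight (β : ℝ) {n₀ n₁ n₂ n₃ : ℕ} (U : FinTorusSite n₀ n₁ n₂ n₃ × Fin 4 → G) : ℝ :=
  Real.exp (-β * ∑ x : FinTorusSite n₀ n₁ n₂ n₃, ∑ q : {q : Fin 4 × Fin 4 // q.1 < q.2},
      ((N : ℝ) - (ρ (finTorusPlaquette U x q.1.1 q.1.2)).trace.re))

/-- The Wilson MEAN of the site-average of a based observable `O U x` on the torus `n₀ × n₁ × n₂ × n₃` (site-averaging avoids choosing a
base point; by translation invariance it is the mean of any single `O · x`).  `Z > 0` is the tree's `wilsonFinTorusPartition_pos`. [folklore] -/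
def finTorusSiteMean (β : ℝ) (n₀ n₁ n₂ n₃ : ℕ)
    (O : (FinTorusSite n₀ n₁ n₂ n₃ × Fin 4 → G) → FinTorusSite n₀ n₁ n₂ n₃ → ℝ) : ℝ :=
  (∫ U, ((∑ x : FinTorusSite n₀ n₁ n₂ n₃, O U x) / (Fintype.card (FinTorusSite n₀ n₁ n₂ n₃) : ℝ))
        * finTorusWilsonWeight ρ β U
      ∂(Measure.pi fun _ : FinTorusSite n₀ n₁ n₂ n₃ × Fin 4 => haarProbability G))
    / wilsonFinTorusPartition ρ β n₀ n₁ n₂ n₃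

/-- `N_L(R,T)` — the charged eared-staple MEAN (Fredenhagen–Marcu numerator) on the slot's box `L³ × ⌊L∕4⌋`. -/
def overlapNum (β : ℝ) (L R T : ℕ) : ℝ :=
  finTorusSiteMean ρ β L L L (L / 4) (earedStapleObs ρ R T)

/-- `D_L(R,S)` — the charged-rectangle MEAN (Fredenhagen–Marcu denominator before the square root) on the slot's box `L³ × ⌊L∕4⌋`. -/
def overlapDen (β : ℝ) (L R S : ℕ) : ℝ :=
  finTorusSiteMean ρ β L L L (L / 4) (chargedRectObs ρ R S)

/-- **`ScreenedAt ρ β L q` — THE RULER READING (the OVERLAP SCALING QUOTIENT of the box is at least `q`).**  With `u = ⌊L∕16⌋`, big staple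
`(R,T) = (4u,2u)` over the charged square `4u × 4u`, small staple `(2u,u)` over `2u × 2u`:
`Q_L := [N_L(4u,2u) ∕ √D_L(4u,4u)] ∕ [N_L(2u,u) ∕ √D_L(2u,2u)] ≥ q`, typed division-free with its positivity guards.  A DOUBLE ratio: the
Fredenhagen–Marcu square root cancels the perimeter ∕ corner self-energies of the doubled staple, the big∕small quotient cancels the local
(coupling-dependent but geometry-independent) renormalisation of the plaquette ears and of the ear–staple junctions — so `Q_L` is a unit-free,
twist-free, CENTRE-BLIND reading with (heuristically) a continuum limit at fixed physical box, separating `q_fem(G) < 1` (Coulombic at its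
own scale; Gaussian part `2⁻⁴`) from `1` (gluon-screened at its own scale: FM scale-free). [cite: FredenhagenMarcu1983] -/
def ScreenedAt (β : ℝ) (L : ℕ) (q : ℝ) : Prop :=
  0 < overlapNum ρ β L (2 * (L / 16)) (L / 16) ∧ 0 < overlapDen ρ β L (4 * (L / 16)) (4 * (L / 16)) ∧
    0 < overlapDen ρ β L (2 * (L / 16)) (2 * (L / 16)) ∧
    q * (overlapNum ρ β L (2 * (L / 16)) (L / 16) * Real.sqrt (overlapDen ρ β L (4 * (L / 16)) (4 * (L / 16)))) ≤
      overlapNum ρ β L (4 * (L / 16)) (2 * (L / 16)) * Real.sqrt (overlapDen ρ β L (2 * (L / 16)) (2 * (L / 16)))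

end Ruler

/-! ## §2 The two statements of the cut (+ the slot's N by name) -/

/-- **S1ev `PinnedScreenedEventually` — FREDENHAGEN–MARCU SCALE-FREENESS IS REACHED UNDER THE PIN, ON ARBITRARILY FINE LATTICES, AT EVERY
LARGE COUPLING (wall-1, eventually-form).**  For simply-connected compact simple `G`, every faithful `r`, every positive unit map `a → 0` with
`LowerBounds G r a`, and every level `q < 1`: there is a pin `T` such that for every fineness `L₁` there is a `β₁` beyond which EVERY `β` has some
`L ≥ max 16 L₁` with `a(β)·L ≤ T ∧ ScreenedAt r.ρ β L q` (`Q_L ≥ q`).  Heuristic: in a gluon-screened box the FM amplitude is scale-free, `Q_L → 1`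
as the box grows in string-breaking units, and a floor-respecting unit is at most a fixed multiple of the physical one at every large `β`, so
`T = T(q)` floor units suffice.  Why it might fail: the floor's units are too coarse for a screened box to be pinned at some cofinal sequence of
couplings (`a(β)·ℓ_s(β)∕a_phys(β)` unbounded), or the heuristic UV-cancellation in `Q_L` fails.  Without the floor it is FALSE (slow units put every
pinned box in the femto regime).  Implies the IRcof line's cofinal S1 trivially.  NO CONSTANT is typed.  PRICE: no engine beyond strong coupling
(first lemma F1′ `ScreenedAtStrongCouplingSimple`, §5b; the rev-0 F1 `ScreenedAtStrongCoupling` is refuted as typed for abelian `G`). -/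
def PinnedScreenedEventually : Prop :=
  ∀ (G : Type) [Group G] [TopologicalSpace G] [IsTopologicalGroup G] [CompactSpace G],
    IsCompactSimpleLieGroup G → SimplyConnectedSpace G →
    letI : MeasurableSpace G := borel G
    haveI : BorelSpace G := ⟨rfl⟩
    ∀ (r : LatticeRep G) (a : ℝ → ℝ), (∀ β, 0 < a β) → Tendsto a atTop (𝓝 0) → LowerBounds G r a →
      ∀ q : ℝ, q < 1 → ∃ T : ℝ, ∀ L₁ : ℕ, ∃ β₁ : ℝ, ∀ β : ℝ, β₁ ≤ β →
        ∃ L : ℕ, max 16 L₁ ≤ L ∧ a β * (L : ℝ) ≤ T ∧ ScreenedAt r.ρ β L q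

/-- **S2 `ScreenedToPure θ` — SOME SUB-UNITY LEVEL OF FM SCALE-FREENESS AT SCALE `L` CERTIFIES `θ`-PURITY AT SCALE `κL`, UNIFORMLY IN
THE COUPLING (floor-free, unit-free, twist-free; the F ⇒ V arrow, wall-2).**  For simply-connected compact simple `G` (ANY centre) and every
`r`: there are a level `q < 1`, a factor `κ ≥ 1`, a `β₀` and a fineness `L₁` such that for all `β ≥ β₀` and `L ≥ max 16 L₁`,
`ScreenedAt r.ρ β L q → coldDefect r.ρ β (κL) ≤ θ`.  One-scale folklore: the femto (asymptotically free) value of `Q_L` is a tree-level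
number `q_fem(G) < 1` (Gaussian part `≈ 2⁻⁴` from the dimension `2` of each chromomagnetic ear, dressed by an `O(1)` finite-torus ∕ toron
factor), so any `q ∈ (q_fem, 1)` forces `g²(ℓ)` bounded below, i.e. a PHYSICAL lower bound on the box and an upper bound on its temperature,
whence `κ(q)·ℓ` is cold and vacuum-dominated.  Why it might fail: `q_fem(G) ≥ 1` for the slot's geometry (computable: tree-level lattice
perturbation theory of `Q_L` with torons — the line's cheapest falsifier), or a two-scale Yang–Mills world (`sup_β` cold-pure scale ∕
screening scale `= ∞`); census C4: no printed implication at either arrow.  `∃ β₀, L₁` absorb bulk transitions of exotic `r` and lattice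
artefacts of small staples.  NO CONSTANT is typed: the level is existentially quantified.  RUNG (PROVED, §5): inside the Dobrushin door one
group-free `κ` works at every level (hypothesis unused). -/
def ScreenedToPure (θ : ℝ) : Prop :=
  ∀ (G : Type) [Group G] [TopologicalSpace G] [IsTopologicalGroup G] [CompactSpace G],
    IsCompactSimpleLieGroup G → SimplyConnectedSpace G →
    letI : MeasurableSpace G := borel G
    haveI : BorelSpace G := ⟨rfl⟩
    ∀ r : LatticeRep G, ∃ q : ℝ, q < 1 ∧
      ∃ κ : ℕ, ∃ β₀ : ℝ, ∃ L₁ : ℕ, 1 ≤ κ ∧ ∀ β : ℝ, β₀ ≤ β → ∀ L : ℕ, max 16 L₁ ≤ L →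
        ScreenedAt r.ρ β L q → coldDefect r.ρ β (κ * L) ≤ θ

/-! ## §3 Stubs (sorries ONLY here) -/

/-- **stub S1ev** — every level `q < 1` of FM scale-freeness is reached by pinned boxes on arbitrarily fine lattices, at every large coupling, under the floor. -/
theorem stub_pinnedScreenedEventually : PinnedScreenedEventually := by
  sorry

/-- **stub S2** — some level `q < 1` at `L` ⇒ `1∕24`-pure at `κL`, `κ` uniform in `β` (the located residual: one-scale YM). -/
theorem stub_screenedToPure : ScreenedToPure (1 / 24) := by
  sorry

/-- **N** — the supplier slot's non-simply-connected half, BY NAME (`ColdPressurePincer.IRnsc`; other rows own it). -/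
theorem stub_irnsc : IRnsc := by
  sorry

/-! ## §4 The composition onto the token PX (PROVED, stub-free) -/

/-- **`S1ev ∧ S2(θ) ⇒ PX(θ)` (PROVED).**  S2 supplies the level `q < 1` with `κ, β₀, L₁`; S1ev at that level gives the pin `T` and, at fineness
`L₁`, a threshold `β₁`; for every `β ≥ max β₁ β₀` S1ev gives a pinned box with `Q_L ≥ q` and S2 reads `coldDefect (κL) ≤ θ` — pinned by `κT`.
No centre case-split, no constant. -/
theorem px_of_overlap {θ : ℝ} (h1 : PinnedScreenedEventually) (h2 : ScreenedToPure θ) : PinnedExitAt θ := by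
  intro G _ _ _ _ hGs hsc
  letI : MeasurableSpace G := borel G
  haveI : BorelSpace G := ⟨rfl⟩
  intro r a ha ha0 hlb
  obtain ⟨q, hq, κ, β₀, L₁, hκ, hup⟩ := h2 G hGs hsc r
  obtain ⟨T, hev⟩ := h1 G hGs hsc r a ha ha0 hlb q hq
  obtain ⟨β₁, hall⟩ := hev L₁
  refine ⟨(κ : ℝ) * T, max β₁ β₀, fun β hβ => ?_⟩
  obtain ⟨L, hL, hpin, hscr⟩ := hall β ((le_max_left _ _).trans hβ)
  refine ⟨κ * L, ?_, ?_, hup β ((le_max_right _ _).trans hβ) L hL hscr⟩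
  · calc 8 ≤ 16 := by norm_num
      _ ≤ max 16 L₁ := le_max_left _ _
      _ ≤ L := hL
      _ = 1 * L := (one_mul L).symm
      _ ≤ κ * L := Nat.mul_le_mul_right L hκ
  · have hk : (0 : ℝ) ≤ (κ : ℝ) := Nat.cast_nonneg κ
    calc a β * ((κ * L : ℕ) : ℝ) = (κ : ℝ) * (a β * (L : ℝ)) := by push_cast; ring
      _ ≤ (κ : ℝ) * T := mul_le_mul_of_nonneg_left hpin hk

/-! ## §5 S2's rung at strong coupling (PROVED) and the line's first lemma (typed) -/

/-- **S2 at strong coupling, ONE group-free `κ`:** for every `θ > 0` there is `κ ≥ 1` such that for every compact `G`, every `r`, every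
`0 ≤ β ≤ 1∕(216N)`, every `L ≥ 16` and every level `q`, `ScreenedAt r.ρ β L q → coldDefect r.ρ β (κL) ≤ θ` — from the landed cold-purity
corner `ColdPurityDobrushin.coldExitAt_corner_of_dobrushinTV` (the hypothesis is not used: inside the door every long box is pure). -/
theorem screenedToPure_rung_dobrushin {θ : ℝ} (hθ : 0 < θ) :
    ∃ κ : ℕ, 1 ≤ κ ∧ ∀ (G : Type) [Group G] [TopologicalSpace G] [IsTopologicalGroup G] [CompactSpace G]
      [MeasurableSpace G] [BorelSpace G] (r : LatticeRep G) (β : ℝ), 0 ≤ β → 216 * (r.N : ℝ) * β ≤ 1 →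
      ∀ L : ℕ, 16 ≤ L → ∀ q : ℝ, ScreenedAt r.ρ β L q → coldDefect r.ρ β (κ * L) ≤ θ := by
  obtain ⟨L₀, hL₀⟩ := coldExitAt_corner_of_dobrushinTV hθ
  refine ⟨max L₀ 1, le_max_right _ _, fun G _ _ _ _ _ _ r β h0 hβ L hL q _ => ?_⟩
  refine hL₀ G r β h0 hβ (max L₀ 1 * L) ?_
  calc L₀ ≤ max L₀ 1 := le_max_left _ _
    _ = max L₀ 1 * 1 := (mul_one _).symm
    _ ≤ max L₀ 1 * L := Nat.mul_le_mul_left _ (by omega)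

/-- S2's strong-coupling corner in S2's own quantifier shape (bookkeeping over the rung): for `θ > 0`, every compact `G`, every `r` and
every `β` in the Dobrushin door, the body of `ScreenedToPure θ` holds at that `β` with level `q := 0`, `β₀ := β`, `L₁ := 0`. -/
theorem screenedToPure_at_dobrushin {θ : ℝ} (hθ : 0 < θ) (G : Type) [Group G] [TopologicalSpace G] [IsTopologicalGroup G]
    [CompactSpace G] [MeasurableSpace G] [BorelSpace G] (r : LatticeRep G) (β : ℝ) (h0 : 0 ≤ β) (hβ : 216 * (r.N : ℝ) * β ≤ 1) :
    ∃ q : ℝ, q < 1 ∧ ∃ κ : ℕ, 1 ≤ κ ∧ ∀ L : ℕ, max 16 0 ≤ L → ScreenedAt r.ρ β L q → coldDefect r.ρ β (κ * L) ≤ θ := by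
  obtain ⟨κ, hκ, h⟩ := screenedToPure_rung_dobrushin hθ
  exact ⟨0, by norm_num, κ, hκ, fun L hL hs => h G r β h0 hβ L (by simpa using hL) 0 hs⟩

/-! ## §5b The line's FIRST LEMMA toward S1ev, typed (a `Prop`, no sorry; located-B): screening at strong coupling

rev 1 of the port (unit `ym-ir-idea-21` g5, 2026-08-28) = the IRcof line's rev-2 repair, verbatim: the rev-0 first lemma F1
`ScreenedAtStrongCoupling` is FALSE AS TYPED — pool prover `ym-ir-line-pool-p3` g16, `Cruxes/IRcof/Lines/overlap_ruler_abelian_negative.lean`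
(crux write c942a8e28728; `AbelianNegative.not_screenedAtStrongCoupling`, axioms standard; critic TYPEREAD CLEAN + UPHELD, crit-3 g4
2026-08-28T22:35:56Z): F1 has no `IsCompactSimpleLieGroup G` binder (unlike S1ev ∕ S2), and for abelian `G` the Haar twirl is the identity,
`earedStapleObs ≡ 0`, `N_L ≡ 0`, the guard `0 < N_L(2u,u)` of `ScreenedAt` fails at every `(β, L, q)`; witness `G = U(1)`, `N = 1`,
`β = 1∕216`, `q = 0`; class MISSTATED.  F1 is KEPT below verbatim as the settled negative edge and SUPERSEDED by **F1′
`ScreenedAtStrongCouplingSimple`** := F1 + `IsCompactSimpleLieGroup G →` (text identical to pool-p3's recorded repair and to the IRcof line's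
rev-2 F1′).  `LatticeRep` is faithful by definition, so under simplicity the twirl is a genuine conditional expectation and the abelian ∕
trivial junk class is excluded; `SimplyConnectedSpace G` is immaterial for a strong-coupling calibration lemma (crit-3 g4).  Nothing else in the
port changes: S1ev ∕ S2 ∕ `px_of_overlap` ∕ the rung ∕ `IR_of_stubs` never mention F1. -/

/-- **F1 (rev 0) `ScreenedAtStrongCoupling` — REFUTED AS TYPED (abelian `G`: `AbelianNegative.not_screenedAtStrongCoupling`, pool-p3 g16
c942a8e28728); kept verbatim as the negative edge, superseded by F1′ `ScreenedAtStrongCouplingSimple` below.**  Original gloss: the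
Fredenhagen–Marcu ∕ Bietenholz–Wiese strong-coupling TUBE picture on the slot's boxes, for every compact `G` (← the slip: no simplicity binder),
every faithful `r`, every `0 < β` with `216·N·β ≤ 1` and every level `q < 1`. [cite: FredenhagenMarcu1983] -/
def ScreenedAtStrongCoupling : Prop :=
  ∀ (G : Type) [Group G] [TopologicalSpace G] [IsTopologicalGroup G] [CompactSpace G] [MeasurableSpace G] [BorelSpace G]
    (r : LatticeRep G) (β : ℝ), 0 < β → 216 * (r.N : ℝ) * β ≤ 1 →
    ∀ q : ℝ, q < 1 → ∃ L₁ : ℕ, ∀ L : ℕ, L₁ ≤ L → ScreenedAt r.ρ β L q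

/-- **F1′ `ScreenedAtStrongCouplingSimple` (the port's located FIRST LEMMA of record)** — the Fredenhagen–Marcu ∕ Bietenholz–Wiese
strong-coupling TUBE picture as a theorem target, on the slot's boxes `L³ × ⌊L∕4⌋`: for every compact SIMPLE Lie group `G`, every (faithful)
`r : LatticeRep G`, every `0 < β` with `216·N·β ≤ 1` and every level `q < 1` there is a fineness `L₁` with `ScreenedAt r.ρ β L q` (`Q_L ≥ q`)
for all `L ≥ L₁` (numerator and charged square dominated by the minimal plaquette tubes along the doubled staple resp. the square's perimeter,
by convergent polymer ∕ character expansion inside the Dobrushin door; equal tube weights per unit length make each Fredenhagen–Marcu ratio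
`R,T`-independent up to exponentially small corrections, so the quotient tends to `1`; FM83 prove the `ℤ₂`-Higgs analogue this way).  The ruler's
CALIBRATION and S1ev's strong-coupling corner (minus the pin); no width toward PX (sieve S3: inoperative as `β → ∞`).  Why it might fail: at the
staple sizes `(2u,u)` the area term of the charged square competes with the perimeter tube until `u` is large (absorbed by `∃ L₁`); a sign slip in
the leading tube coefficient of `N_L` would break the guard `0 < N_L` (cheapest falsifier: that coefficient for `SU(2)` fundamental).
[cite: FredenhagenMarcu1983] -/
def ScreenedAtStrongCouplingSimple : Prop :=
  ∀ (G : Type) [Group G] [TopologicalSpace G] [IsTopologicalGroup G] [CompactSpace G] [MeasurableSpace G] [BorelSpace G],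
    IsCompactSimpleLieGroup G →
    ∀ (r : LatticeRep G) (β : ℝ), 0 < β → 216 * (r.N : ℝ) * β ≤ 1 →
    ∀ q : ℝ, q < 1 → ∃ L₁ : ℕ, ∀ L : ℕ, L₁ ≤ L → ScreenedAt r.ρ β L q

/-- F1 ⇒ F1′ (bookkeeping: the repair only ADDS a hypothesis). -/
theorem screenedAtStrongCouplingSimple_of (h : ScreenedAtStrongCoupling) : ScreenedAtStrongCouplingSimple :=
  fun G _ _ _ _ _ _ _ r β hβ hN q hq => h G r β hβ hN q hq

/-- F1′ in S1ev's quantifier currency inside the Dobrushin door (bookkeeping): for compact simple `G`, every `r`, every `0 < β ≤ 1∕(216N)`,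
every level `q < 1` and every fineness `L₁`, some `L ≥ max 16 L₁` reads `Q_L ≥ q` — S1ev's body at that `β` minus the pin `a(β)·L ≤ T`. -/
theorem screened_eventually_of_simple (h : ScreenedAtStrongCouplingSimple) (G : Type) [Group G] [TopologicalSpace G]
    [IsTopologicalGroup G] [CompactSpace G] [MeasurableSpace G] [BorelSpace G] (hG : IsCompactSimpleLieGroup G)
    (r : LatticeRep G) (β : ℝ) (h0 : 0 < β) (hβ : 216 * (r.N : ℝ) * β ≤ 1) (q : ℝ) (hq : q < 1) (L₁ : ℕ) :
    ∃ L : ℕ, max 16 L₁ ≤ L ∧ ScreenedAt r.ρ β L q := by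
  obtain ⟨L₂, hL₂⟩ := h G hG r β h0 hβ q hq
  exact ⟨max (max 16 L₁) L₂, le_max_left _ _, hL₂ _ (le_max_right _ _)⟩

/-- The ruler reading is monotone in the level (bookkeeping; a lower level is easier to certify). -/
theorem screenedAt_mono {G : Type} [Group G] [TopologicalSpace G] [IsTopologicalGroup G] [CompactSpace G]
    [MeasurableSpace G] [BorelSpace G] {N : ℕ} (ρ : G →* Matrix (Fin N) (Fin N) ℂ) {β : ℝ} {L : ℕ} {q q' : ℝ}
    (hle : q' ≤ q) (h : ScreenedAt ρ β L q) : ScreenedAt ρ β L q' := by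
  obtain ⟨hN, hD, hD', hQ⟩ := h
  refine ⟨hN, hD, hD', le_trans ?_ hQ⟩
  exact mul_le_mul_of_nonneg_right hle (mul_nonneg hN.le (Real.sqrt_nonneg _))

/-! ## §6 Composition onto the supplier slot: the route decl `IR` BY NAME -/

/-- The bill as ONE proposition (behind a `def`, so that `IR_of_stubs` is the file's only crux-headed theorem). -/
def Bill : Prop :=
  PinnedScreenedEventually → ScreenedToPure (1 / 24) → IRnsc → Summit.QuantumFields.YangMills.Theses.BalabanLadder.IR

/-- **The bill holds (PROVED composition, stub-free):** `S1ev → S2 → N → IR` — the token PX(1∕24) by `px_of_overlap`, the simply-connected half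
by the landed kernel `PinnedExit96.irsc_of_pinnedExit_le`, the `π₁ ≠ 1` half = N, joined by `ColdPressurePincer.IR_of_cases`. -/
theorem IR_of : Bill := by
  intro h1 h2 hN
  exact IR_of_cases (irsc_of_pinnedExit_le (by norm_num) (px_of_overlap h1 h2)) hN

/-- **`IR` (the supplier route decl, literally) from the three registered stubs.** -/
theorem IR_of_stubs : Summit.QuantumFields.YangMills.Theses.BalabanLadder.IR :=
  IR_of stub_pinnedScreenedEventually stub_screenedToPure stub_irnsc

/-- The supplier token PX(1∕24) (tree decl `PinnedExit96.PinnedExitAt (1/24)`) from the stubs. -/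
theorem px24_of_stubs : PinnedExitAt (1 / 24) :=
  px_of_overlap stub_pinnedScreenedEventually stub_screenedToPure

end Summit.QuantumFields.YangMills.Cruxes.IR.OverlapRuler
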